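import Summits.QuantumAdvantage.AdviceFreeQNC0.ExpBridge
import Summits.QuantumAdvantage.AdviceFreeQNC0.SqrtDegreeHardness
import Literature.Computability.Complexity.BallGates
import Literature.Computability.MetaComplexity.SmolenskyRelationsBallGates
import HarnessLib

/-!
# Cell qa-qnc0 (rung F-Q1⁺): the `GC⁰(k)[p]` bridge `LongGridCycle → GCRelationalRS p → RingHardLinSqrt p → HLFNotGC0ModExp p`

Planner qa-qnc0-p2 g12, ROUND-12 §A / `Sketch12b.lean` §4–§6: statements **F-Q1⁺ `HLFNotGC0ModExp p`**
(Grewal–Kumar 2024, arXiv:2408.16406 §1.3 open question 5 for `p`, OR-trick regime), **E6 `GCRelationalRS p`**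
(the relational Razborov–Smolensky layer over the basis `gcBasis k p` = `{¬, MOD_p} ∪ G(k)` of
`Literature/Computability/Complexity/BallGates.lean`), **P4 `GCBridgePlan p`** and **P6 `ExpGivesPoly p`**, typed
VERBATIM except that `gcBasis` is the tree's `Literature.Computability.Complexity.gcBasis` (same body as Sketch12b's),
and the proofs

* `gcBridge : GCBridgePlan p` (every prime `p`) — `ExpBridge.lean`'s bridge with the relational Razborov–Smolensky
  lemma for `accBasis p` (`Smolensky.exists_uniformProb_le`, degree `((p-1)ℓ)^{d+1}`) replaced by the HYPOTHESIS
  `GCRelationalRS p` (degree `((k+1)((p-1)ℓ+1))^{d+1}`): with `ℓ = M + 2(log₂ N + 1) + ⌈3/δ⌉` one has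
  `(p-1)ℓ + 1 ≤ (p-1)(⌈3/δ⌉ + 5)(M + log₂ N)`, so the degree is `≤ A·((k+1)(M + log₂ N))^{d+1} ≤ N/2 - 1 ≤ ⌊√n⌋`
  under the hypothesis `c·((k+1)(M + log₂ N))^{d+1} ≤ N`, `c = 2A + 2`, `A = ((p-1)(⌈3/δ⌉ + 5))^{d+1}`; the
  error term `N²(2^M + 2)/p^ℓ ≤ δ` is the same (`ExpBridge` arithmetic).
* `hlfNotFAC0ModExp_of_gc : HLFNotGC0ModExp p → HLFNotFAC0ModExp p` (`k = 0`, `accBasis p ⊆ gcBasis 0 p`) and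
  `expGivesPoly : ExpGivesPoly p`.
* **E5 `GCRazborovSmolensky p`** and **P5 `GCRelationalPlan p`** (Sketch12b §5–§6 verbatim) — CLOSED for every prime
  `p` by qa-qnc0-lit g14's kernel theorems `Smolensky.razborov_smolensky_gc` / `Smolensky.exists_uniformProb_le_gc`
  (`Literature/Computability/MetaComplexity/SmolenskyRelationsBallGates.lean`, on top of `RazborovSmolenskyBall*.lean`:
  Grewal–Kumar 2024 Thm 3.8 in product form): `gcRazborovSmolensky`, `gcRelationalRS`, `gcRelationalPlan`.
* **`hlfNotGC0ModExp_two : HLFNotGC0ModExp 2` — F-Q1⁺ PROVED UNCONDITIONALLY**: `gcBridge 2 longGridCycle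
  (gcRelationalRS 2) ringHardLinSqrt_two` (`LongGridCycle.lean`, `SqrtDegreeHardness.lean`).

So Grewal–Kumar 2024 §1.3 open question 5 ("separations between `QNC⁰` and `GC⁰(k)[p]` without giving the quantum
circuit an advice state") is answered for `p = 2` in the OR-trick regime: 2D HLF (solved with certainty by BGK's
constant-depth quantum circuit, tree `qnc0Solves_hlfFamily`) defeats depth-`d` `GC⁰(k)[2]` circuit families of size
`2^M` with uniformly random shared bits whenever `c_d·((k+1)(M + log₂ N))^{d+1} ≤ N` — `k` up to `N^{1/(d+1)}/polylog`,
size up to `2^{N^{1/(d+1)}/((k+1)·c)}` — with one gap `θ < 1` for all `d`, and NO advice on either side.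

WHAT THIS IS NOT: not GK's sharp additive regime (`HLFNotGC0ModExpSharp`: `c·(k + M + log₂ N)^{d+1} ≤ N`, needs
Srinivasan–Tripathi–Venkitesh 2021 Thm 18); nothing for odd `p` beyond the implications (`RingHardLinSqrt p` is open
for odd `p`); the rung leaf / route bookkeeping is the coordinator's; separation NOT moved on the ledger by this file.
-/

noncomputable section

open Finset Polynomial
open Literature.Computability.Cryptography Literature.Computability.Complexity
open Literature.Computability.QuantumComplexity Literature.Computability.MetaComplexity

namespace Summit.QuantumAdvantage.AdviceFreeQNC0

/-! ### Statements (qa-qnc0-p2 Sketch12b §4, §5, §6 — verbatim, over the tree's `gcBasis`) -/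

/-- **F-Q1⁺(p) `HLFNotGC0ModExp p`: 2D HLF is hard for `GC⁰(k)[p]/rpoly`** (Grewal–Kumar 2024,
arXiv:2408.16406 §1.3 open question 5, case `p`; OR-trick regime): depth `d`, gates from
`gcBasis k p`, size `≤ 2^M`, whenever `c_d·((k+1)(M + log₂ N))^{d+1} ≤ N` — so `k = polylog`,
quasipolynomial size (GK's regime (i)) and `k = N^{ε}`, size `2^{N^{ε}}` for `ε < 1/(2d+2)`.
(Sketch12b §4, verbatim; `gcBasis` = `Literature.Computability.Complexity.gcBasis`.) -/
def HLFNotGC0ModExp (p : ℕ) : Prop :=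
  ∃ θ : ℝ, θ < 1 ∧ ∀ d : ℕ, ∃ c N₀ : ℕ, ∀ N ≥ N₀, ∀ k M : ℕ,
    c * ((k + 1) * (M + Nat.log 2 N)) ^ (d + 1) ≤ N →
    ∀ (r : ℕ) (Cs : Fin N × Fin N → Circuit (Fin (inLen N + r))),
      (∀ v, (Cs v).IsOver (gcBasis k p)) → (∀ v, (Cs v).acDepth ≤ d) →
      (∀ v, (Cs v).size ≤ 2 ^ M) →
      ∃ I : HLFInstance N, I.IsValid ∧
        uniformProb r
          {ρ | (fun v => (Cs v).eval (Fin.append (encodeHLF I) fun i => ρ.getD i false)) ∈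
            hlfSolutions I} ≤ θ

/-- **E6 `GCRelationalRS p`** (Sketch12b §5, verbatim; `gcBasis` = the tree's) — the relational layer
(`SmolenskyRelations.exists_uniformProb_le`: hard-wiring via `Circuit.exists_subst` over `gcBasis ⊇ acBasis`,
ONE error set for all outputs, averaging over the random bits) over `gcBasis k p`, at degree
`((k+1)((p-1)ℓ+1))^{d+1}`.  Size M given the multi-output ball-gate Razborov–Smolensky lemma (E5). -/
def GCRelationalRS (p : ℕ) [Fact p.Prime] : Prop :=
  open scoped Classical in
  ∀ (k K n r m d ℓ : ℕ), 1 ≤ ℓ →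
    ∀ (e : (Fin K → Bool) → (Fin n → Bool)),
      (∀ i, (∃ b, ∀ u, e u i = b) ∨ (∃ j, ∀ u, e u i = u j)) →
    ∀ (C : Fin m → Circuit (Fin (n + r))),
      (∀ v, (C v).IsOver (gcBasis k p)) → (∀ v, (C v).acDepth ≤ d) →
    ∀ (W : (Fin K → Bool) → (Fin m → Bool) → Prop) (B : ℝ),
      (∀ P : Fin m → Smolensky.CubeFn (ZMod p) K,
        (∀ v, P v ∈ Smolensky.lowDeg (ZMod p) K (((k + 1) * ((p - 1) * ℓ + 1)) ^ (d + 1))) →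
          ((univ.filter fun u => W u fun v => decide (P v u = 1)).card : ℝ) ≤ B) →
      ∃ u : Fin K → Bool,
        uniformProb r {ρ | W u fun v => (C v).eval (Fin.append (e u) fun i => ρ.getD i false)} ≤
          B / 2 ^ K + (∑ v, ((C v).size + 2 : ℝ)) / (p : ℝ) ^ ℓ

/-- **P4 `GCBridgePlan p`** (Sketch12b §6, verbatim; M given E6): the `GC⁰(k)[p]` bridge (any prime `p`). -/
def GCBridgePlan (p : ℕ) [Fact p.Prime] : Prop :=
  LongGridCycle → GCRelationalRS p → RingHardLinSqrt p → HLFNotGC0ModExp p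

/-- **E5 `GCRazborovSmolensky p`** (Sketch12b §5, verbatim; `gcBasis` = the tree's) — the tree's
`Smolensky.razborov_smolensky` with `accBasis p` replaced by `gcBasis k p` and the per-layer degree `(p-1)ℓ` replaced
by `(k+1)((p-1)ℓ + 1)`: a ball gate with centre `c`, outside value `b`, in the shifted variables `w_i = v_i ⊕ c_i`, is
`b + (1 - q(w))·(f_k(w) - b)` with `f_k` the degree-`≤ k` Möbius interpolant on the ball (GK Lemma 3.4) and `q`
Smolensky's OR-polynomial for "some `(k+1)`-set of flipped coordinates".  PROVED by qa-qnc0-lit g14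
(`Smolensky.razborov_smolensky_gc`). -/
def GCRazborovSmolensky (p : ℕ) [Fact p.Prime] : Prop :=
  ∀ (k n : ℕ) (C : Circuit (Fin n)), C.IsOver (gcBasis k p) → ∀ ℓ : ℕ, 1 ≤ ℓ →
    ∃ (P : Smolensky.CubeFn (ZMod p) n) (E : Finset (Fin n → Bool)),
      P ∈ Smolensky.lowDeg (ZMod p) n (((k + 1) * ((p - 1) * ℓ + 1)) ^ C.acDepth) ∧
      E.card * p ^ ℓ ≤ C.size * 2 ^ n ∧
      ∀ x, x ∉ E → P x = Smolensky.bit p (C.eval x)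

/-- **P5 `GCRelationalPlan p`** (Sketch12b §6, verbatim): the relational layer from the single-circuit lemma. -/
def GCRelationalPlan (p : ℕ) [Fact p.Prime] : Prop := GCRazborovSmolensky p → GCRelationalRS p

/-- **P6 `ExpGivesPoly p`** (Sketch12b §6, verbatim; S): sanity — the exponential statements imply the polynomial
one of the rung leaf, and `GC` implies `AC` (`accBasis ⊆ gcBasis 0`). -/
def ExpGivesPoly (p : ℕ) : Prop :=
  (HLFNotFAC0ModExp p → HLFNotFAC0Mod p) ∧ (HLFNotGC0ModExp p → HLFNotFAC0ModExp p)

/-! ### Arithmetic of the parameters -/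

/-- `⌊N/2⌋ ≤ ⌊√n⌋` when `N² ≤ 4n`. -/
private theorem half_le_sqrt' {N n : ℕ} (h : N * N ≤ 4 * n) : N / 2 ≤ Nat.sqrt n := by
  rw [Nat.le_sqrt]
  have h2 : 2 * (N / 2) ≤ N := Nat.mul_div_le N 2
  have h3 : 2 * (N / 2) * (2 * (N / 2)) ≤ N * N := Nat.mul_le_mul h2 h2
  nlinarith

/-- `(p-1)ℓ + 1 ≤ (p-1)(E+5)(M+L)` for `ℓ = M + 2(L+1) + E`, `L ≥ 1`, `p ≥ 2`. -/
private theorem ell_le' {p M L E : ℕ} (hp : 2 ≤ p) (hL : 1 ≤ L) :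
    (p - 1) * (M + 2 * (L + 1) + E) + 1 ≤ (p - 1) * (E + 5) * (M + L) := by
  have h1 : M + 2 * (L + 1) + E + 1 ≤ (E + 5) * (M + L) := by
    have : E * 1 ≤ E * L := Nat.mul_le_mul_left E hL
    nlinarith
  have hp1 : 1 ≤ p - 1 := by omega
  calc (p - 1) * (M + 2 * (L + 1) + E) + 1
      ≤ (p - 1) * (M + 2 * (L + 1) + E) + (p - 1) * 1 := by omega
    _ = (p - 1) * (M + 2 * (L + 1) + E + 1) := by ring
    _ ≤ (p - 1) * ((E + 5) * (M + L)) := Nat.mul_le_mul_left _ h1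
    _ = (p - 1) * (E + 5) * (M + L) := by ring

/-- The error term: `N²(2^M + 2) ≤ δ·p^ℓ` for `ℓ = M + 2(L+1) + E`, `L = log₂ N`, `3 ≤ δ·2^E`, `2 ≤ p`. -/
private theorem error_le' {p N M E : ℕ} {δ : ℝ} (hp : 2 ≤ p) (hE : (3 : ℝ) ≤ δ * (2 : ℝ) ^ E) (hδ : 0 ≤ δ) :
    (N : ℝ) * N * ((2 : ℝ) ^ M + 2) ≤ δ * (p : ℝ) ^ (M + 2 * (Nat.log 2 N + 1) + E) := by
  set L : ℕ := Nat.log 2 N with hL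
  have hN2 : (N : ℝ) * N ≤ (2 : ℝ) ^ (2 * (L + 1)) := by
    have h := (Nat.lt_pow_succ_log_self one_lt_two N).le
    have h' : N * N ≤ 2 ^ (L + 1) * 2 ^ (L + 1) := Nat.mul_le_mul h h
    rw [← pow_add, show L + 1 + (L + 1) = 2 * (L + 1) by ring] at h'
    exact_mod_cast h'
  have hM3 : (2 : ℝ) ^ M + 2 ≤ 3 * (2 : ℝ) ^ M := by
    have : (1 : ℝ) ≤ (2 : ℝ) ^ M := one_le_pow₀ (by norm_num)
    linarith
  have hpℓ : (2 : ℝ) ^ (M + 2 * (L + 1) + E) ≤ (p : ℝ) ^ (M + 2 * (L + 1) + E) := by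
    exact_mod_cast Nat.pow_le_pow_left hp _
  calc (N : ℝ) * N * ((2 : ℝ) ^ M + 2)
      ≤ (2 : ℝ) ^ (2 * (L + 1)) * (3 * (2 : ℝ) ^ M) :=
        mul_le_mul hN2 hM3 (by positivity) (by positivity)
    _ = 3 * ((2 : ℝ) ^ M * (2 : ℝ) ^ (2 * (L + 1))) := by ring
    _ ≤ δ * (2 : ℝ) ^ E * ((2 : ℝ) ^ M * (2 : ℝ) ^ (2 * (L + 1))) :=
        mul_le_mul_of_nonneg_right hE (by positivity)
    _ = δ * (2 : ℝ) ^ (M + 2 * (L + 1) + E) := by rw [pow_add, pow_add]; ring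
    _ ≤ δ * (p : ℝ) ^ (M + 2 * (L + 1) + E) := mul_le_mul_of_nonneg_left hpℓ hδ

/-! ### The `GC⁰(k)[p]` bridge -/

/-- **`LongGridCycle → GCRelationalRS p → RingHardLinSqrt p → HLFNotGC0ModExp p`** (ROUND-12 §A.3 E5/P4):
`ExpBridge.lean`'s argument with the relational Razborov–Smolensky lemma over `gcBasis k p` as a hypothesis;
threshold `(1 + θ₀)/2` from the ring threshold `θ₀` at slope `K = 1`. -/
theorem hlfNotGC0ModExp_of_ringHardLinSqrt (p : ℕ) [Fact p.Prime] (hL : LongGridCycle)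
    (hRS : GCRelationalRS p) (hR : RingHardLinSqrt p) : HLFNotGC0ModExp p := by
  classical
  have hp := (Fact.out : p.Prime)
  obtain ⟨N₁, hN₁⟩ := hL
  obtain ⟨θ₀, hθ₀, n₀, hn₀⟩ := hR 1
  set δ : ℝ := (1 - θ₀) / 2 with hδ
  have hδpos : 0 < δ := by rw [hδ]; linarith
  refine ⟨θ₀ + δ, by rw [hδ]; linarith, fun d => ?_⟩
  -- the constants: `E` with `3 ≤ δ·2^E`, and `c`
  set E : ℕ := ⌈3 / δ⌉₊ with hE
  have h3E : (3 : ℝ) ≤ δ * (2 : ℝ) ^ E := by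
    have h1 : (3 : ℝ) / δ ≤ E := by rw [hE]; exact Nat.le_ceil _
    have h2 : (E : ℝ) ≤ (2 : ℝ) ^ E := by exact_mod_cast (@Nat.lt_two_pow_self E).le
    have h3 : (3 : ℝ) / δ ≤ (2 : ℝ) ^ E := h1.trans h2
    rw [div_le_iff₀ hδpos] at h3
    linarith
  set A : ℕ := ((p - 1) * (E + 5)) ^ (d + 1) with hA
  refine ⟨2 * A + 2, max (max 4 N₁) (2 * n₀ + 2), fun N hN k M hcM r Cs hover hdep hsize => ?_⟩
  have hN4 : 4 ≤ N := le_trans (le_max_left _ _) (le_trans (le_max_left _ _) hN)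
  have hNN₁ : N₁ ≤ N := le_trans (le_max_right _ _) (le_trans (le_max_left _ _) hN)
  have hNn₀ : 2 * n₀ + 2 ≤ N := le_trans (le_max_right _ _) hN
  -- the long cycle
  obtain ⟨n, hn4, ⟨γ⟩⟩ := hN₁ N hNN₁
  have hsq : N / 2 ≤ Nat.sqrt n := half_le_sqrt' hn4
  have hsqn : (N / 2) * (N / 2) ≤ n := Nat.le_sqrt.mp hsq
  have hn3 : 3 ≤ n := by
    have : 2 ≤ N / 2 := by omega
    nlinarith
  have hnn₀ : n₀ ≤ n := by
    have h1 : n₀ + 1 ≤ N / 2 := by omega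
    have h2 : (n₀ + 1) * (n₀ + 1) ≤ (N / 2) * (N / 2) := Nat.mul_le_mul h1 h1
    nlinarith
  -- the Razborov–Smolensky parameter
  set L : ℕ := Nat.log 2 N with hL
  have hL1 : 1 ≤ L := by rw [hL]; exact Nat.log_pos one_lt_two (by omega)
  set ℓ : ℕ := M + 2 * (L + 1) + E with hℓ
  have hℓ1 : 1 ≤ ℓ := by rw [hℓ]; omega
  -- degree: `((k+1)((p-1)ℓ+1))^{d+1} ≤ ⌊√n⌋`
  have hdeg : ((k + 1) * ((p - 1) * ℓ + 1)) ^ (d + 1) ≤ 1 * Nat.sqrt n := by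
    have hℓle : (p - 1) * ℓ + 1 ≤ (p - 1) * (E + 5) * (M + L) := by rw [hℓ]; exact ell_le' hp.two_le hL1
    have hD : ((k + 1) * ((p - 1) * ℓ + 1)) ^ (d + 1) ≤ A * ((k + 1) * (M + L)) ^ (d + 1) := by
      calc ((k + 1) * ((p - 1) * ℓ + 1)) ^ (d + 1)
          ≤ ((k + 1) * ((p - 1) * (E + 5) * (M + L))) ^ (d + 1) :=
            Nat.pow_le_pow_left (Nat.mul_le_mul_left _ hℓle) _
        _ = A * ((k + 1) * (M + L)) ^ (d + 1) := by
            rw [hA, ← mul_pow]; congr 1; ring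
    have hB1 : 1 ≤ ((k + 1) * (M + L)) ^ (d + 1) := Nat.one_le_pow _ _ (by positivity)
    have h2 : 2 * ((k + 1) * ((p - 1) * ℓ + 1)) ^ (d + 1) + 2 ≤ N := by
      calc 2 * ((k + 1) * ((p - 1) * ℓ + 1)) ^ (d + 1) + 2
          ≤ 2 * (A * ((k + 1) * (M + L)) ^ (d + 1)) + 2 * ((k + 1) * (M + L)) ^ (d + 1) := by omega
        _ = (2 * A + 2) * ((k + 1) * (M + L)) ^ (d + 1) := by ring
        _ ≤ N := hcM
    omega
  -- the polynomial-map bound from `RingHardLinSqrt` (slope `1`) at ring length `n`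
  have hB : ∀ P : Fin (N * N) → Smolensky.CubeFn (ZMod p) n,
      (∀ j, P j ∈ Smolensky.lowDeg (ZMod p) n (((k + 1) * ((p - 1) * ℓ + 1)) ^ (d + 1))) →
        ((univ.filter fun x : Fin n → Bool =>
            (fun v => (fun j => decide (P j x = 1)) (finProdFinEquiv v)) ∈
              hlfSolutions (γ.ringInstance x)).card : ℝ) ≤ θ₀ * (2 : ℝ) ^ n := by
    intro P hP
    let Q : Fin n → Smolensky.CubeFn (ZMod p) n := fun i => P (finProdFinEquiv (γ.toFun i))
    have hQ : ∀ i, Q i ∈ Smolensky.lowDeg (ZMod p) n (1 * Nat.sqrt n) :=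
      fun i => Smolensky.lowDeg_mono hdeg (hP _)
    have hring := hn₀ n hnn₀ Q hQ
    refine le_trans ?_ hring
    exact_mod_cast card_le_card fun x hx => by
      simp only [mem_filter, mem_univ, true_and] at hx ⊢
      exact GridCycle.rel_of_mem_hlfSolutions hn3 x hx
  -- the relational Razborov–Smolensky hypothesis over `gcBasis k p`
  obtain ⟨x, hx⟩ := hRS k n (inLen N) r (N * N) d ℓ hℓ1
    (fun x : Fin n → Bool => encodeHLF (γ.ringInstance x))
    (GridCycle.encodeHLF_ringInstance_subst γ)
    (fun j : Fin (N * N) => Cs (finProdFinEquiv.symm j))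
    (fun j => hover _) (fun j => hdep _)
    (fun x z => (fun v => z (finProdFinEquiv v)) ∈ hlfSolutions (γ.ringInstance x)) _ hB
  refine ⟨γ.ringInstance x, GridCycle.ringInstance_isValid x, ?_⟩
  simp only [Equiv.symm_apply_apply] at hx
  refine hx.trans ?_
  -- the two error terms
  have h2n : (2 : ℝ) ^ n ≠ 0 := pow_ne_zero _ two_ne_zero
  rw [mul_div_assoc, div_self h2n, mul_one]
  refine add_le_add le_rfl ?_
  have hpℓpos : (0 : ℝ) < (p : ℝ) ^ ℓ := by
    have : (0 : ℝ) < p := by exact_mod_cast hp.pos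
    positivity
  have hsum : (∑ j : Fin (N * N), (((Cs (finProdFinEquiv.symm j)).size : ℝ) + 2)) ≤
      (N : ℝ) * N * ((2 : ℝ) ^ M + 2) := by
    calc (∑ j : Fin (N * N), (((Cs (finProdFinEquiv.symm j)).size : ℝ) + 2))
        ≤ ∑ _j : Fin (N * N), ((2 : ℝ) ^ M + 2) :=
          sum_le_sum fun j _ => by
            have := hsize (finProdFinEquiv.symm j)
            exact add_le_add (by exact_mod_cast this) le_rfl
      _ = (N : ℝ) * N * ((2 : ℝ) ^ M + 2) := by
          rw [sum_const, card_univ, Fintype.card_fin, nsmul_eq_mul]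
          push_cast
          ring
  calc (∑ j : Fin (N * N), (((Cs (finProdFinEquiv.symm j)).size : ℝ) + 2)) / (p : ℝ) ^ ℓ
      ≤ (N : ℝ) * N * ((2 : ℝ) ^ M + 2) / (p : ℝ) ^ ℓ := div_le_div_of_nonneg_right hsum hpℓpos.le
    _ ≤ δ := by
        rw [div_le_iff₀ hpℓpos, hℓ, hL]
        exact error_le' hp.two_le h3E hδpos.le

/-- **P4 `GCBridgePlan p` — PROVED** for every prime `p`. -/
theorem gcBridge (p : ℕ) [Fact p.Prime] : GCBridgePlan p :=
  hlfNotGC0ModExp_of_ringHardLinSqrt p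

/-! ### `GC` implies `AC` -/

/-- **`HLFNotGC0ModExp p → HLFNotFAC0ModExp p`** (second half of P6): an `accBasis p`-circuit is a
`gcBasis 0 p`-circuit (`accBasis_subset_gcBasis`), and at `k = 0` the two size/degree conditions coincide. -/
theorem hlfNotFAC0ModExp_of_gc (p : ℕ) (h : HLFNotGC0ModExp p) : HLFNotFAC0ModExp p := by
  obtain ⟨θ, hθ, H⟩ := h
  refine ⟨θ, hθ, fun d => ?_⟩
  obtain ⟨c, N₀, hc⟩ := H d
  refine ⟨c, N₀, fun N hN M hcM r Cs hover hdep hsize => ?_⟩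
  refine hc N hN 0 M (by simpa using hcM) r Cs (fun v => (hover v).mono (accBasis_subset_gcBasis 0 p))
    hdep hsize

/-- **P6 `ExpGivesPoly p` — PROVED.** -/
theorem expGivesPoly (p : ℕ) : ExpGivesPoly p :=
  ⟨hlfNotFAC0Mod_of_exp p, hlfNotFAC0ModExp_of_gc p⟩

/-! ### E5, E6, P5 from the landed ball-gate Razborov–Smolensky chain (qa-qnc0-lit g14) -/

/-- **E5 `GCRazborovSmolensky p` — PROVED** (every prime `p`): qa-qnc0-lit g14's `Smolensky.razborov_smolensky_gc`
(`SmolenskyRelationsBallGates.lean`, from `razborov_smolensky_ball`, Grewal–Kumar 2024 Thm 3.8 in product form). -/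
theorem gcRazborovSmolensky (p : ℕ) [Fact p.Prime] : GCRazborovSmolensky p :=
  fun k n C hC ℓ hℓ => Smolensky.razborov_smolensky_gc k n C hC ℓ hℓ

/-- **E6 `GCRelationalRS p` — PROVED** (every prime `p`): qa-qnc0-lit g14's `Smolensky.exists_uniformProb_le_gc`. -/
theorem gcRelationalRS (p : ℕ) [Fact p.Prime] : GCRelationalRS p :=
  fun k K n r m d ℓ hℓ e he C hC hd W B hB =>
    Smolensky.exists_uniformProb_le_gc k K n r m d ℓ hℓ e he C hC hd W B hB

/-- **P5 `GCRelationalPlan p` — PROVED** (trivially, E6 being a theorem). -/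
theorem gcRelationalPlan (p : ℕ) [Fact p.Prime] : GCRelationalPlan p := fun _ => gcRelationalRS p

/-! ### Rung F-Q1⁺ closed -/

/-- **Rung F-Q1⁺: `HLFNotGC0ModExp 2` — PROVED UNCONDITIONALLY** (Grewal–Kumar 2024 §1.3 Q5 for `p = 2`, OR-trick
regime): 2D HLF defeats exponential-size `GC⁰(k)[2]/rpoly` with uniformly random shared bits and no quantum advice. -/
theorem hlfNotGC0ModExp_two : HLFNotGC0ModExp 2 :=
  gcBridge 2 longGridCycle (gcRelationalRS 2) ringHardLinSqrt_two

/-- The `GC⁰(k)[p]` statement for every prime `p`, conditional only on ring hardness at `𝔽_p`-degree `⌊√n⌋`. -/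
theorem hlfNotGC0ModExp_of_ringHardLinSqrt' (p : ℕ) [Fact p.Prime] (h : RingHardLinSqrt p) :
    HLFNotGC0ModExp p :=
  gcBridge p longGridCycle (gcRelationalRS p) h

end Summit.QuantumAdvantage.AdviceFreeQNC0

end
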